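import Summits.Ventures.Crystal3D.Bulk.GapActiveFaces
import Mathlib.Analysis.InnerProductSpace.Dual
import HarnessLib

/-!
# Every oriented face of the tight map lies in an OPEN HEMISPHERE (the hemisphere clause of
# LEMMA L; route 1 of `HOME/lean/lemmaL/DESIGN.md`)

HONEST FRAMING. Part of the venture `Summits/Ventures/Crystal3D` (cell `pub-crystal3d`, phase 2;
seat p3). Kernel theorem about every configuration satisfying `CensusRows c`; nothing is claimed
about GAP(1.26). LEMMA L of the cell's `DESIGN-L12-THEORY.md` reads "every face of `T′` is a
convex spherical polygon CONTAINED IN AN OPEN HEMISPHERE". Convex position of the vertex cycle is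
`CensusRows.orient3_oface_neg` (`Bulk/GapActiveFaces.lean`); the hemisphere clause is the
elementary fact that a cyclically oriented family admits a linear functional positive on all of
it (the functional `det[v₀;v₁;·] + det[v₁;v₂;·] + det[v_{n−1};v₀;·]` of the tree's proof of Euclid
XI.21):

* `exists_functional_pos_of_convexPos` (generic, `ℝ³`): all increasingly indexed triples of
  `v 0, …, v (n−1)` positively oriented (`n ≥ 3`) ⇒ some linear functional is `> 0` on every
  `v i`; `exists_inner_pos_of_convexPos` — the same with a vector `z`, `0 < ⟪z, v i⟫`;
* **`CensusRows.exists_inner_neg_oface`** — for every dart `q` of the tight map there is a vector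
  `z` with `⟪z, gapDir c (φ°^[t] q).1⟫ < 0` for all `t < ofaceLen c q`: the vertices of the face
  lie in the open hemisphere `{⟪z, ·⟫ < 0}` (the walk being clockwise, the functional of the
  antipodal cycle is used).
-/

noncomputable section

namespace Summit.Ventures.Crystal3D

open Literature.Geometry.DiscreteGeometry Finset Function
open scoped InnerProductSpace

variable {c : Fin 14 → EuclideanSpace ℝ (Fin 3)}

/-- **A cyclically oriented family lies in an open half-space**: if all increasingly indexed
triples of `v 0, …, v (n−1)` (`n ≥ 3`) are positively oriented, the functional
`det[v₀;v₁;·] + det[v₁;v₂;·] + det[v_{n−1};v₀;·]` is positive on every `v i`. -/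
theorem exists_functional_pos_of_convexPos {n : ℕ} (hn : 3 ≤ n)
    {v : ℕ → EuclideanSpace ℝ (Fin 3)}
    (hv : ∀ i j k, i < j → j < k → k < n → 0 < orient3 (v i) (v j) (v k)) :
    ∃ φ : EuclideanSpace ℝ (Fin 3) →ₗ[ℝ] ℝ, ∀ i, i < n → 0 < φ (v i) := by
  refine ⟨orient3Right (v 0) (v 1) + orient3Right (v 1) (v 2) + orient3Right (v (n - 1)) (v 0),
    fun i hi => ?_⟩
  simp only [LinearMap.add_apply, orient3Right_apply]
  have c1 : ∀ i j k, i < j → j < k → k < n → 0 < orient3 (v j) (v k) (v i) := by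
    intro i j k hij hjk hk; rw [← orient3_cyclic]; exact hv i j k hij hjk hk
  have c2 : ∀ i j k, i < j → j < k → k < n → 0 < orient3 (v k) (v i) (v j) := by
    intro i j k hij hjk hk; rw [orient3_cyclic]; exact hv i j k hij hjk hk
  rcases Nat.lt_or_ge i 3 with hi3 | hi3
  · interval_cases i
    · rw [orient3_self_outer, orient3_self_right, zero_add, add_zero]
      exact c1 0 1 2 (by omega) (by omega) (by omega)
    · rw [orient3_self_right, orient3_self_outer, zero_add, zero_add]
      exact c2 0 1 (n - 1) (by omega) (by omega) (by omega)
    · rcases Nat.lt_or_ge 3 n with h4 | h3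
      · rw [orient3_self_right, add_zero]
        exact add_pos (hv 0 1 2 (by omega) (by omega) (by omega))
          (c2 0 2 (n - 1) (by omega) (by omega) (by omega))
      · have hn3 : n = 3 := by omega
        subst hn3
        rw [orient3_self_right, add_zero, show 3 - 1 = 2 from rfl, orient3_self_outer, add_zero]
        exact hv 0 1 2 (by omega) (by omega) (by omega)
  · rcases eq_or_lt_of_le (Nat.le_sub_one_of_lt hi : i ≤ n - 1) with h | h
    · rw [h, orient3_self_outer, add_zero]
      refine add_pos (hv 0 1 (n - 1) (by omega) (by omega) (by omega)) ?_
      rcases Nat.lt_or_ge 3 n with h4 | h3'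
      · exact hv 1 2 (n - 1) (by omega) (by omega) (by omega)
      · omega
    · exact add_pos (add_pos (hv 0 1 i (by omega) (by omega) hi) (hv 1 2 i (by omega) hi3 hi))
        (c2 0 i (n - 1) (by omega) h (by omega))

/-- The same with a vector: some `z` has `0 < ⟪z, v i⟫` for all `i < n`. -/
theorem exists_inner_pos_of_convexPos {n : ℕ} (hn : 3 ≤ n) {v : ℕ → EuclideanSpace ℝ (Fin 3)}
    (hv : ∀ i j k, i < j → j < k → k < n → 0 < orient3 (v i) (v j) (v k)) :
    ∃ z : EuclideanSpace ℝ (Fin 3), ∀ i, i < n → 0 < ⟪z, v i⟫_ℝ := by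
  obtain ⟨φ, hφ⟩ := exists_functional_pos_of_convexPos hn hv
  refine ⟨(InnerProductSpace.toDual ℝ (EuclideanSpace ℝ (Fin 3))).symm
    (LinearMap.toContinuousLinearMap φ), fun i hi => ?_⟩
  rw [InnerProductSpace.toDual_symm_apply]
  exact hφ i hi

/-- **The hemisphere clause of LEMMA L.** For every dart `q` of the tight map of a census
configuration there is a vector `z` with `⟪z, u⟫ < 0` for every vertex direction `u` of the face
walk of `q`: the face lies in an open hemisphere. -/
theorem CensusRows.exists_inner_neg_oface (h : CensusRows c) {q : Fin 14 × Fin 14}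
    (hq : q ∈ darts c) :
    ∃ z : EuclideanSpace ℝ (Fin 3), ∀ t, t < ofaceLen c q →
      ⟪z, gapDir c ((ofaceSucc c)^[t] q).1⟫_ℝ < 0 := by
  have h3 := h.three_le_ofaceLen hq
  obtain ⟨z, hz⟩ := exists_inner_pos_of_convexPos h3
    (v := fun t => -gapDir c ((ofaceSucc c)^[t] q).1) (by
      intro i j k hij hjk hk
      rw [HullRotSys.orient3_neg_neg_neg, neg_pos]
      exact h.orient3_oface_neg hq hij hjk hk)
  refine ⟨z, fun t ht => ?_⟩
  have := hz t ht
  simp only [inner_neg_right] at this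
  linarith

end Summit.Ventures.Crystal3D
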